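import Literature.MathematicalPhysics.QuantumFieldTheory.Balaban1983to89.T4InputCauchyRateTermwise
import Literature.Probability.LatticeModels.HardCoreUrsell
import Summits.QuantumFields.BalabanUV.T4Continuum.Support.ClusterRepOfDomains
import HarnessLib

/-!
# NE5 ∕ U3 — the TERM FAMILY of the one-step output functional (claim-table row O1-d, part d2 «term definition»):
# the Ursell terms of [Balaban1988RG2Cluster] (2.13)∘(2.9)∘Σ(2.14) as functionals of (operator datum, inserted history),
# `Out := ∑'` of them, and the STRUCTURAL exp-linear form of every term in the history species

Cell `pub-balaban`, unit `b2b-balaban-t4-ne5-formalise-leaf-08` (NE5 formalisation swarm, LEAF PROVER 08; row O1-d2 of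
`t4/b2b-balaban-t4-ne5-p1/O1-CLAIM-TABLE-NE5-P1.md` v1.2, design `B13StepDesign.md` v0.2 §3 O1-d).  Summits-side NEW WORK
under the LEAN PLACEMENT RULE (cell modelling + bookkeeping, NOT a Literature module).  HONEST FRAMING: rung (B)+1 of the
FINITE-VOLUME T⁴ continuum programme — NOT infinite volume, NOT a mass gap, NOT the Clay problem, and NOT a proof of NE5
(NOT PRINTED in [Balaban1987RG1]–[Balaban1989LargeFieldII]: they print ε-UNIFORM bounds, never η-RATES).  HONEST DEPENDENCY
(cell line, verbatim): continuum YM on T⁴ ⇐ BetaPertH ∧ nine spine estimates (0/9 proved); BetaPertH ⇐ (D1) ∧ (D4) ∧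
CAP+tail; G-an2-4 gates asym, D1 and NE2/3/4.  This file discharges NO wall of the NE5 skeleton; it TYPES the term family
through which the owner's P1 skeleton (`SKELETON-NE5-P1.md`, leaf rows L01/L02/L04) reads Bałaban's one-step map, so that
O1 = «`def B13Step : StepModel …`» becomes «instantiate the parameters below on rows O1-a/b/c/d1's objects».

WHAT IS TYPED (design RULE R1: ONE output functional for BOTH runs, no lattice spacing inside — the two runs differ only
in the DATA `(o, h)` fed to it):
* §1 `rhoT inc Z` — the Ursell coefficient ρᵀ(Z₁,…,Zₙ) of an ORDERED TUPLE of polymers for the hard core `inc`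
  (ζ(Z, Z′) = 0), as the tree's Möbius-defined hard-core Ursell coefficient `Literature.Probability.LatticeModels.hcUrsell`
  of the tuple's incompatibility graph BY NAME ([Balaban1988RG2Cluster] (2.12) p. 14 prints *"ρ^T(Z) = 1, and
  ρ^T(Z₁,…,Z_n) = Σ_{g∈C_n} Π_{{i,j}∈g}(ζ(Z_i, Z_j) − 1), C_n is the set of connected graphs on the set {1,…,n}"* — the
  connected-graph form is the tree's `Dimock2011to13.UrsellConnectedGraphSum.hcUrsell_eq_connSum`, not re-proved here);
* §2 `TermIndexing C ι P J` — HOW an index `i : ι` of the term family decodes: a tuple length, the tuple of polymers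
  `poly i : Fin (len i + 1) → P`, the tuple of (2.14)-labels `lab i` (which resummed term of which activity: (Z₀, 𝐃, P) in
  print), and the LOCALIZATION relation `Rel k i X` ("the tuple consists of step-`k` polymers whose union is `X`, with
  admissible labels" — (2.13)'s constraint ∪Z_i = X).  The index TYPES themselves are row O1-d1's (unit …-leaf-02); this
  structure is the socket they plug into.  `TermIndexing.canonical` is the reference instance over the carriers' own
  domain geometry (`ClusterRepOfDomains.DomainGeometry`, route P2's p207054, BY NAME): ι = Σ n, (Fin (n+1) → C.Dom) ×
  (Fin (n+1) → J), the support of a localizing tuple being a covering family of P2's `clus X` (`support_mem_clus`);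
* §3 THE TERMS: `term 𝒯 inc act k i o h X = 𝟙[Rel k i X] · ((n+1)!)⁻¹ ρᵀ(poly i) · Π_m act (poly i m) (lab i m) o h` for
  ACTIVITY TERMS `act : P → J → Op → Hist → ℂ` (the resummed terms (2.14) of `H(Z)` as functionals of the two-species input;
  their definition on Bałaban's objects is rows O1-b/c + route P2's term model), and `out 𝒯 inc act k o h X := ∑' i, term …`
  — (2.13) *"E^{(k+1)}(X) = Σ_{n=1}^∞ (1/n!) Σ_{(Z₁,…,Z_n): ∪Z_i = X} ρ^T(Z₁,…,Z_n)H(Z₁)…H(Z_n)"* with H(Z) = Σ_j act Z j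
  multiplied out.  `out` is BY DEFINITION the series of the family (`out_eq_tsum`, rfl), which is the form row O1-d3
  (`TermRep` on the class, unit …-leaf-04) consumes; `hasSum_term_out` records `TermRep` wherever the family is summable.
* §4 THE STRUCTURE OF THE HISTORY SPECIES: if every activity term factor of a localizing tuple is, at the class operator
  point, an integral `∫ Φ(o,a)·exp(Λ(o,a) h) dν(o)` of a history-free weight against the exponential of a continuous linear
  functional of the history (hypothesis shape `ActExpLinearOn` — the printed FORM of (2.14) p. 15: the potentials enter
  ONLY through *"exp[Σ_{Y∈𝐃} τ(Y)𝐕_k(Y,B)]"*), then the Ursell terms satisfy the termwise leaf's STRUCTURAL shape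
  `T4InputCauchyRateTermwise.TermHistExpLinear` with the EXHIBITED data (μ, Φ, Λ) = (product measure of the factors'
  measures, 𝟙·coefficient·Π weights, Σ of the factors' functionals) — `termHistExpLinear_of_actExpLinear` (Fubini on
  `Measure.pi`, `exp Σ = Π exp`) — hence `TermHistLineAnalytic` with NO analyticity hypothesis on the history species
  (`termHistLineAnalytic_of_actExpLinear`, via the leaf's `termHistLineAnalytic_of_expLinear` BY NAME).  This is the
  claim table's «history half STRUCTURAL via `TermHistExpLinear` once O1-d exhibits (μ, Φ, Λ)».
* §5 a non-vacuity witness (one polymer, `act = exp(o + h)` against a Dirac mass).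
WHAT IS *NOT* CLAIMED.  No estimate: `TermBound`∕`TermBudget` (the convergence of (2.13) — print p. 20 *"The above lemma
implies that sufficient conditions for convergence of the series (2.12), (2.13) are satisfied, see [26, 67, 25, 50]"*) stay
DISPLAYED hypotheses of the termwise leaf (trigger c3∕c6); the operator half `TermOpLineAnalytic` is mathematics not in
print (c6) and is untouched; the identification of `out` with the tree's Kotecký–Preiss form of (2.13)
(`B13Resummation.locE` ∕ route P2's `ClusterRep.outB = Σ_{K ∈ clus X} Φᵀ(K)`) is the classical Mayer identity
Φᵀ(K) = Σ_{tuples supported on K} (1/n!)ρᵀ·ΠH (Cammarota 1982; [KP86]) and is NOT proved here (recorded for the owner as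
the junction question of the two routes' MI-R); nothing of the manuscripts under audit is asserted (cited for FORM∕locus
only).  0 sorry; axioms ⊆ {propext, Classical.choice, Quot.sound}.
-/

noncomputable section

open MeasureTheory
open scoped BigOperators

namespace Summit.QuantumFields.BalabanUV.T4Continuum.B13StepTermFamily

open Literature.MathematicalPhysics.QuantumFieldTheory.Balaban1983to89.T4OutputRate (Carriers)
open Literature.MathematicalPhysics.QuantumFieldTheory.Balaban1983to89.T4InputCauchyRateData (StepModel)
open Literature.MathematicalPhysics.QuantumFieldTheory.Balaban1983to89.T4InputCauchyRateTermwise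
  (TermRep TermHistExpLinear TermHistLineAnalytic termHistLineAnalytic_of_expLinear)
open Literature.Probability.LatticeModels (hcUrsell)
open Summit.QuantumFields.BalabanUV.T4Continuum.ClusterRepOfDomains (DomainGeometry)

/-! ## §1 The Ursell coefficient of an ordered tuple of polymers -/

section Ursell

variable {P : Type*} (inc : P → P → Prop) [DecidableRel inc]

/-- [folklore] ρᵀ(Z₁,…,Zₙ) for an ordered tuple `Z : Fin n → P` under the hard core `inc` (ζ(Z, Z′) = 0 ⟺ `inc Z Z′`):
the tree's hard-core Ursell coefficient `hcUrsell` of the tuple's incompatibility graph on `Fin n` (its value on connected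
graphs is `hcUrsell_eq_connSum` of the Dimock lineage; (2.12) p. 14 of [Balaban1988RG2Cluster] prints that form). -/
def rhoT {n : ℕ} (Z : Fin n → P) : ℤ := hcUrsell (fun m m' : Fin n => inc (Z m) (Z m')) Finset.univ

/-- [folklore] ρᵀ of a single polymer is `1` ((2.12): *"ρ^T(Z) = 1"*). -/
theorem rhoT_one (Z : Fin 1 → P) : rhoT inc Z = 1 := by
  unfold rhoT
  rw [Finset.univ_unique]
  exact Literature.Probability.LatticeModels.hcUrsell_singleton _

/-- [folklore] The same for a tuple type `Fin (n + 1)` with `n = 0` (dependent-length form used by the term family). -/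
theorem rhoT_of_len_zero : ∀ {n : ℕ}, n = 0 → ∀ Z : Fin (n + 1) → P, rhoT inc Z = 1
  | _, rfl, Z => rhoT_one inc Z

end Ursell

/-! ## §2 How a term index decodes: tuple of polymers, tuple of labels, localization relation -/

/-- [folklore] DATA (no inequality inside): the decoding of the index type `ι` of the term family — tuple length
(`len i + 1 ≥ 1` factors), the tuple of polymers, the tuple of (2.14)-labels, and the localization relation
`Rel k i X` ((2.13)'s *"(Z₁,…,Z_n): ∪Z_i = X"* at step `k`, with admissible labels), decidable. -/
structure TermIndexing (C : Carriers) (ι P J : Type*) where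
  /-- number of factors minus one -/
  len : ι → ℕ
  /-- the ordered tuple of polymers of the index -/
  poly : (i : ι) → Fin (len i + 1) → P
  /-- the (2.14)-label of each factor -/
  lab : (i : ι) → Fin (len i + 1) → J
  /-- the tuple localizes at the step-`k` domain `X` -/
  Rel : ℕ → ι → C.Dom → Prop
  /-- decidability of the localization relation -/
  decRel : ∀ k i X, Decidable (Rel k i X)

namespace TermIndexing

/-- [folklore] The localization relation is decidable (field `decRel`). -/
instance instDecidableRel {C : Carriers} {ι P J : Type*} (𝒯 : TermIndexing C ι P J) (k : ℕ) (i : ι) (X : C.Dom) :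
    Decidable (𝒯.Rel k i X) := 𝒯.decRel k i X

variable {C : Carriers} [DecidableEq C.Dom] {Cube : Type*} [DecidableEq Cube] {J : Type*} [DecidableEq J]

/-- [folklore] The reference index type over the carriers' domains: Σ n, (ordered (n+1)-tuples of domains) × (labels). -/
abbrev CanonIdx (C : Carriers) (J : Type*) : Type _ := Σ n : ℕ, (Fin (n + 1) → C.Dom) × (Fin (n + 1) → J)

/-- [folklore] THE REFERENCE INDEXING over a `DomainGeometry` of the carriers (route P2's p207054) and a label catalogue
`labels Z` (the finitely many resummed terms of `H(Z)`): a tuple localizes at `X` at step `k` iff `X` and every member are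
step-`k` domains, the members' footprints cover `X`'s exactly, and every label is admissible. -/
def canonical (G : DomainGeometry C Cube) (labels : C.Dom → Finset J) : TermIndexing C (CanonIdx C J) C.Dom J where
  len i := i.1
  poly i := i.2.1
  lab i := i.2.2
  Rel k i X := C.scale X = k ∧ (∀ m, C.scale (i.2.1 m) = k) ∧
    Finset.univ.biUnion (fun m => G.cubes (i.2.1 m)) = G.cubes X ∧ ∀ m, i.2.2 m ∈ labels (i.2.1 m)
  decRel _ _ _ := by infer_instance

/-- [folklore] The reference index type is countable when domains and labels are (finite torus: both are finite). -/
instance [Countable C.Dom] [Countable J] : Countable (CanonIdx C J) := by infer_instance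

/-- [folklore] Unfolding the reference localization relation. -/
theorem canonical_rel_iff (G : DomainGeometry C Cube) (labels : C.Dom → Finset J) (k : ℕ) (i : CanonIdx C J)
    (X : C.Dom) : (canonical G labels).Rel k i X ↔ C.scale X = k ∧ (∀ m, C.scale (i.2.1 m) = k) ∧
      Finset.univ.biUnion (fun m => G.cubes (i.2.1 m)) = G.cubes X ∧ ∀ m, i.2.2 m ∈ labels (i.2.1 m) := Iff.rfl

/-- [folklore] CONSISTENCY WITH ROUTE P2's COVERING FAMILIES: the support `{Z₁,…,Zₙ}` of a tuple localizing at `X` is a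
member of `DomainGeometry.clus X` (the Kotecký–Preiss index set of `ClusterRep.outB`; the Mayer identity regroups (2.13)'s
tuples by their supports — that regrouping itself is not performed here). -/
theorem support_mem_clus (G : DomainGeometry C Cube) (labels : C.Dom → Finset J) {k : ℕ} {i : CanonIdx C J}
    {X : C.Dom} (h : (canonical G labels).Rel k i X) : Finset.univ.image i.2.1 ∈ G.clus X := by
  obtain ⟨hX, hsc, hcov, -⟩ := h
  rw [DomainGeometry.mem_clus]
  refine ⟨fun Z hZ => ?_, by rw [Finset.image_biUnion]; exact hcov⟩
  obtain ⟨m, -, rfl⟩ := Finset.mem_image.1 hZ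
  exact (G.mem_level _ _).2 ((hsc m).trans hX.symm)

end TermIndexing

/-! ## §3 The Ursell terms and the output functional `out := ∑'` -/

section Terms

variable {C : Carriers} {ι P J Op Hist : Type*} (𝒯 : TermIndexing C ι P J) (inc : P → P → Prop) [DecidableRel inc]
  (act : P → J → Op → Hist → ℂ)

/-- [folklore] The combinatorial coefficient `((n+1)!)⁻¹ ρᵀ(Z₀,…,Zₙ)` of the index `i` ((2.13)'s `1/n!` and ρᵀ). -/
def coeff (i : ι) : ℂ := ((Nat.factorial (𝒯.len i + 1) : ℂ))⁻¹ * (rhoT inc (𝒯.poly i) : ℂ)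

/-- [folklore] **THE TERM** `T k i o h X`: zero unless the tuple of `i` localizes at `X` at step `k`; otherwise the
coefficient times the product of the factors' activity terms read at the SAME two-species input `(o, h)` — one functional
for both runs (design RULE R1; [Balaban1988RG2Cluster] p. 3 (1.5)). -/
def term (k : ℕ) (i : ι) (o : Op) (h : Hist) (X : C.Dom) : ℂ :=
  if 𝒯.Rel k i X then coeff 𝒯 inc i * ∏ m, act (𝒯.poly i m) (𝒯.lab i m) o h else 0

/-- [folklore] **THE OUTPUT FUNCTIONAL** `out k o h X := ∑' i, T k i o h X` — (2.13) multiplied out over the resummed terms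
of the activities, as an unconditional sum (junk `0` where not summable: summability on the class is row O1-d3's `TermRep`,
fed by the displayed `TermBound`∕`TermBudget`). -/
noncomputable def out (k : ℕ) (o : Op) (h : Hist) (X : C.Dom) : ℂ := ∑' i, term 𝒯 inc act k i o h X

/-- [folklore] Off the localization relation the term vanishes. -/
theorem term_of_not_rel {k : ℕ} {i : ι} {X : C.Dom} (h : ¬ 𝒯.Rel k i X) (o : Op) (hh : Hist) :
    term 𝒯 inc act k i o hh X = 0 := if_neg h

/-- [folklore] On the localization relation the term is coefficient × product of activity terms. -/
theorem term_of_rel {k : ℕ} {i : ι} {X : C.Dom} (h : 𝒯.Rel k i X) (o : Op) (hh : Hist) :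
    term 𝒯 inc act k i o hh X = coeff 𝒯 inc i * ∏ m, act (𝒯.poly i m) (𝒯.lab i m) o hh := if_pos h

/-- [folklore] A localizing ONE-polymer index contributes its activity term itself (ρᵀ(Z) = 1, 1! = 1). -/
theorem term_single {k : ℕ} {i : ι} {X : C.Dom} (h : 𝒯.Rel k i X) (hlen : 𝒯.len i = 0) (o : Op) (hh : Hist) :
    term 𝒯 inc act k i o hh X = ∏ m, act (𝒯.poly i m) (𝒯.lab i m) o hh := by
  rw [term_of_rel 𝒯 inc act h, coeff, rhoT_of_len_zero inc hlen (𝒯.poly i)]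
  have h2 : ((Nat.factorial (𝒯.len i + 1) : ℕ) : ℂ) = 1 := by rw [hlen]; simp
  rw [h2]; simp

/-- [folklore] `out` IS the series of the term family (the form `M.Out k o h X = ∑' i, T k i o h X` row O1-d3 consumes). -/
theorem out_eq_tsum (k : ℕ) (o : Op) (h : Hist) (X : C.Dom) :
    out 𝒯 inc act k o h X = ∑' i, term 𝒯 inc act k i o h X := rfl

/-- [folklore] Wherever the family is summable, the output is its sum (`TermRep` pointwise, by definition of `out`). -/
theorem hasSum_term_out {k : ℕ} {o : Op} {h : Hist} {X : C.Dom} (hs : Summable fun i => term 𝒯 inc act k i o h X) :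
    HasSum (fun i => term 𝒯 inc act k i o h X) (out 𝒯 inc act k o h X) := hs.hasSum

variable [NormedAddCommGroup Op] [NormedSpace ℂ Op] [NormedAddCommGroup Hist] [NormedSpace ℂ Hist]

/-- [folklore] `TermRep` FOR ANY STEP MODEL WHOSE OUTPUT IS `out`, on any class on which the family is summable (the
summability itself — from `TermBound`∕`TermBudget` by comparison — is row O1-d3's theorem, not repeated here). -/
theorem termRep_of_summable (M : StepModel C Op Hist) (hM : ∀ k o h X, M.Out k o h X = out 𝒯 inc act k o h X)
    (K : ℕ → (ℕ → ℝ) → C.BgB → Set (Op × Hist)) (W : Set (ℕ → ℝ))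
    (hs : ∀ k, ∀ g ∈ W, ∀ (U : C.BgB) (q : Op × Hist), q ∈ K k g U → ∀ X : C.Dom, C.scale X = k →
      Summable fun i => term 𝒯 inc act k i q.1 q.2 X) :
    TermRep M K (term 𝒯 inc act) W := by
  intro k g hg U q hq X hX
  rw [hM]
  exact hasSum_term_out 𝒯 inc act (hs k g hg U q hq X hX)

end Terms

/-! ## §4 The exp-linear STRUCTURE of the activity terms is inherited by the Ursell terms -/

section ExpLinear

variable {C : Carriers} {ι P J Op Hist Ω : Type*} [NormedAddCommGroup Hist] [NormedSpace ℂ Hist] [MeasurableSpace Ω]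

/-- [folklore] DATA (no inequality inside): per activity term `(Z, j)` and operator point `o`, a measure `ν` (contour
parameters × Gaussian variables of (2.14)), a history-free weight `Φ` and the continuous linear history functional `Λ(a)`
(`h ↦ Σ_Y τ(Y)·(h read at (Y, B(a)))`). -/
structure ActData (P J Op Hist Ω : Type*) [NormedAddCommGroup Hist] [NormedSpace ℂ Hist] [MeasurableSpace Ω] where
  /-- the term's measure at operator point `o` -/
  ν : P → J → Op → Measure Ω
  /-- the history-free weight -/
  Φ : P → J → Op → Ω → ℂ
  /-- the linear history functional -/
  Λ : P → J → Op → Ω → (Hist →L[ℂ] ℂ)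

variable (𝒯 : TermIndexing C ι P J) (inc : P → P → Prop) [DecidableRel inc] (act : P → J → Op → Hist → ℂ)
  (D : ActData P J Op Hist Ω)

/-- [folklore] The measure of the Ursell term `i` at operator point `o`: the product of its factors' measures. -/
noncomputable def tupleMeasure (i : ι) (o : Op) : Measure (Fin (𝒯.len i + 1) → Ω) :=
  Measure.pi fun m => D.ν (𝒯.poly i m) (𝒯.lab i m) o

/-- [folklore] The history-free weight of the Ursell term: 𝟙[Rel] · coefficient · product of the factors' weights. -/
noncomputable def tupleWeight (k : ℕ) (i : ι) (o : Op) (X : C.Dom) (a : Fin (𝒯.len i + 1) → Ω) : ℂ :=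
  if 𝒯.Rel k i X then coeff 𝒯 inc i * ∏ m, D.Φ (𝒯.poly i m) (𝒯.lab i m) o (a m) else 0

/-- [folklore] The linear history functional of the Ursell term: 𝟙[Rel] · the sum of the factors' functionals. -/
noncomputable def tupleFunctional (k : ℕ) (i : ι) (o : Op) (X : C.Dom) (a : Fin (𝒯.len i + 1) → Ω) : Hist →L[ℂ] ℂ :=
  if 𝒯.Rel k i X then ∑ m, D.Λ (𝒯.poly i m) (𝒯.lab i m) o (a m) else 0

/-- [folklore] HYPOTHESIS SHAPE `ActExpLinearOn K W 𝒯 act D` (printed FORM, [Balaban1988RG2Cluster] (2.14)–(2.15) p. 15: in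
the resummed term the potentials enter ONLY through *"exp[Σ_{Y∈𝐃} τ(Y)𝐕_k(Y,B)]"*, a `τ`-linear combination, integrated
against potential-free contour × Gaussian data; NOT PRINTED as a statement over an input class — asserted nowhere): at every
class point `q` of step `k`, for every factor `(Z, j) = (poly i m, lab i m)` of every tuple localizing at a step-`k` domain,
the factor's measure at `q.1` is σ-finite, its weight integrable, its functional a.e.-strongly measurable in `a` for each
history and a.e. bounded in operator norm, and the activity term at `q` IS `∫ Φ(q.1,a)·exp(Λ(q.1,a) q.2) dν(q.1)`. -/
@[folklore]
structure ActExpLinearOn (K : ℕ → (ℕ → ℝ) → C.BgB → Set (Op × Hist)) (W : Set (ℕ → ℝ)) : Prop where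
  sigmaFinite : ∀ k, ∀ g ∈ W, ∀ (U : C.BgB) (q : Op × Hist), q ∈ K k g U → ∀ X : C.Dom, C.scale X = k →
    ∀ i, 𝒯.Rel k i X → ∀ m, SigmaFinite (D.ν (𝒯.poly i m) (𝒯.lab i m) q.1)
  integrable : ∀ k, ∀ g ∈ W, ∀ (U : C.BgB) (q : Op × Hist), q ∈ K k g U → ∀ X : C.Dom, C.scale X = k →
    ∀ i, 𝒯.Rel k i X → ∀ m, Integrable (D.Φ (𝒯.poly i m) (𝒯.lab i m) q.1) (D.ν (𝒯.poly i m) (𝒯.lab i m) q.1)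
  measurable : ∀ k, ∀ g ∈ W, ∀ (U : C.BgB) (q : Op × Hist), q ∈ K k g U → ∀ X : C.Dom, C.scale X = k →
    ∀ i, 𝒯.Rel k i X → ∀ m (y : Hist),
      AEStronglyMeasurable (fun a => D.Λ (𝒯.poly i m) (𝒯.lab i m) q.1 a y) (D.ν (𝒯.poly i m) (𝒯.lab i m) q.1)
  bounded : ∀ k, ∀ g ∈ W, ∀ (U : C.BgB) (q : Op × Hist), q ∈ K k g U → ∀ X : C.Dom, C.scale X = k →
    ∀ i, 𝒯.Rel k i X → ∀ m, ∃ N : ℝ, ∀ᵐ a ∂(D.ν (𝒯.poly i m) (𝒯.lab i m) q.1), ‖D.Λ (𝒯.poly i m) (𝒯.lab i m) q.1 a‖ ≤ N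
  repr : ∀ k, ∀ g ∈ W, ∀ (U : C.BgB) (q : Op × Hist), q ∈ K k g U → ∀ X : C.Dom, C.scale X = k →
    ∀ i, 𝒯.Rel k i X → ∀ m, act (𝒯.poly i m) (𝒯.lab i m) q.1 q.2 =
      ∫ a, D.Φ (𝒯.poly i m) (𝒯.lab i m) q.1 a * Complex.exp (D.Λ (𝒯.poly i m) (𝒯.lab i m) q.1 a q.2)
        ∂(D.ν (𝒯.poly i m) (𝒯.lab i m) q.1)

variable {𝒯 inc act D}

/-- [folklore] **STRUCTURE OF THE HISTORY SPECIES, EXHIBITED**: exp-linear activity terms ⟹ the Ursell term family satisfies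
`TermHistExpLinear` with (μ, Φ, Λ) = (`tupleMeasure`, `tupleWeight`, `tupleFunctional`) — product measure (Fubini on
`Measure.pi`), product of weights times the coefficient, sum of the factors' functionals (`exp Σ = Π exp`). -/
theorem termHistExpLinear_of_actExpLinear {K : ℕ → (ℕ → ℝ) → C.BgB → Set (Op × Hist)} {W : Set (ℕ → ℝ)}
    (h : ActExpLinearOn 𝒯 act D K W) :
    TermHistExpLinear K (term 𝒯 inc act) W (α := fun _ i => Fin (𝒯.len i + 1) → Ω)
      (fun _ i o _ => tupleMeasure 𝒯 D i o) (fun k i o X => tupleWeight 𝒯 inc D k i o X)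
      (fun k i o X => tupleFunctional 𝒯 D k i o X) := by
  intro k g hg U q hq X hX i
  dsimp only
  by_cases hR : 𝒯.Rel k i X
  · have hsf : ∀ m, SigmaFinite (D.ν (𝒯.poly i m) (𝒯.lab i m) q.1) := h.sigmaFinite k g hg U q hq X hX i hR
    have hint := h.integrable k g hg U q hq X hX i hR
    have hmeas := h.measurable k g hg U q hq X hX i hR
    have hbdd := h.bounded k g hg U q hq X hX i hR
    have hrepr := h.repr k g hg U q hq X hX i hR
    have hW : tupleWeight 𝒯 inc D k i q.1 X =
        fun a => coeff 𝒯 inc i * ∏ m, D.Φ (𝒯.poly i m) (𝒯.lab i m) q.1 (a m) := funext fun a => if_pos hR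
    have hΛ : ∀ a, tupleFunctional 𝒯 D k i q.1 X a = ∑ m, D.Λ (𝒯.poly i m) (𝒯.lab i m) q.1 (a m) :=
      fun a => if_pos hR
    refine ⟨?_, ?_, ?_, ?_⟩
    · rw [hW] -- constant × finite product of integrable factors on the product measure
      exact (Integrable.fintype_prod (f := fun m a => D.Φ (𝒯.poly i m) (𝒯.lab i m) q.1 a) hint).const_mul _
    · intro y -- finite sum of compositions with the (quasi-measure-preserving) evaluations
      simp_rw [hΛ, _root_.sum_apply]
      refine Finset.aestronglyMeasurable_fun_sum _ fun m _ => ?_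
      exact (hmeas m y).comp_quasiMeasurePreserving (Measure.quasiMeasurePreserving_eval _ m)
    · choose N hN using hbdd -- sum of the factors' a.e. bounds, transported along the evaluations
      refine ⟨∑ m, N m, ?_⟩
      have hall : ∀ᵐ a ∂(tupleMeasure 𝒯 D i q.1), ∀ m, ‖D.Λ (𝒯.poly i m) (𝒯.lab i m) q.1 (a m)‖ ≤ N m := by
        rw [Filter.eventually_all]; intro m
        exact (Measure.tendsto_eval_ae_ae (μ := fun m => D.ν (𝒯.poly i m) (𝒯.lab i m) q.1) (i := m)).eventually (hN m)
      filter_upwards [hall] with a ha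
      rw [hΛ]
      exact (norm_sum_le _ _).trans (Finset.sum_le_sum fun m _ => ha m)
    · rw [term_of_rel 𝒯 inc act hR] -- Fubini on `Measure.pi` and `exp Σ = Π exp`
      simp_rw [hW, hΛ, _root_.sum_apply, Complex.exp_sum]
      have hprod : ∏ m, act (𝒯.poly i m) (𝒯.lab i m) q.1 q.2 =
          ∫ a : Fin (𝒯.len i + 1) → Ω, ∏ m, (D.Φ (𝒯.poly i m) (𝒯.lab i m) q.1 (a m) *
            Complex.exp (D.Λ (𝒯.poly i m) (𝒯.lab i m) q.1 (a m) q.2))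
            ∂(tupleMeasure 𝒯 D i q.1) := by
        rw [tupleMeasure, integral_fintype_prod_eq_prod
          (f := fun m a => D.Φ (𝒯.poly i m) (𝒯.lab i m) q.1 a * Complex.exp (D.Λ (𝒯.poly i m) (𝒯.lab i m) q.1 a q.2))]
        exact Finset.prod_congr rfl fun m _ => hrepr m
      rw [hprod, ← integral_const_mul]
      refine integral_congr_ae (Filter.Eventually.of_forall fun a => ?_)
      simp only [Finset.prod_mul_distrib]
      ring
  · have hW : tupleWeight 𝒯 inc D k i q.1 X = fun _ => 0 := funext fun a => if_neg hR
    have hΛ : ∀ a, tupleFunctional 𝒯 D k i q.1 X a = 0 := fun a => if_neg hR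
    refine ⟨?_, ?_, ⟨0, ?_⟩, ?_⟩
    · rw [hW]
      exact integrable_zero _ _ _
    · intro y
      simp_rw [hΛ]
      exact aestronglyMeasurable_const
    · exact Filter.Eventually.of_forall fun a => by rw [hΛ, norm_zero]
    · rw [term_of_not_rel 𝒯 inc act hR, hW]
      simp

/-- [folklore] **… HENCE THE HISTORY-LINE ANALYTICITY OF EVERY TERM WITH NO ANALYTICITY HYPOTHESIS** (the termwise leaf's
`termHistLineAnalytic_of_expLinear`, BY NAME). -/
theorem termHistLineAnalytic_of_actExpLinear {K : ℕ → (ℕ → ℝ) → C.BgB → Set (Op × Hist)} {W : Set (ℕ → ℝ)}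
    (h : ActExpLinearOn 𝒯 act D K W) : TermHistLineAnalytic K (term 𝒯 inc act) W :=
  termHistLineAnalytic_of_expLinear (termHistExpLinear_of_actExpLinear (inc := inc) h)

end ExpLinear

/-! ## §5 Non-vacuity: one polymer with activity `exp(o + h)` against a Dirac mass -/

section Toy

open Literature.MathematicalPhysics.QuantumFieldTheory.Balaban1983to89.T4InputCauchyRate (toyCarriers)

/-- [folklore] Toy indexing: index `n` = the (n+1)-tuple of copies of the one polymer, localizing at every step-`k` domain. -/
def toyIndexing : TermIndexing toyCarriers ℕ Unit Unit where
  len n := n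
  poly _ _ := ()
  lab _ _ := ()
  Rel k _ X := toyCarriers.scale X = k
  decRel _ _ _ := by infer_instance

/-- [folklore] Toy activity term `exp(o + h)`. -/
noncomputable def toyAct : Unit → Unit → ℂ → ℂ → ℂ := fun _ _ o h => Complex.exp (o + h)

/-- [folklore] Toy exp-linear data: Dirac mass on the point, weight `exp o`, functional `id`. -/
noncomputable def toyData : ActData Unit Unit ℂ ℂ Unit where
  ν _ _ _ := Measure.dirac ()
  Φ _ _ o _ := Complex.exp o
  Λ _ _ _ _ := ContinuousLinearMap.id ℂ ℂ

/-- [folklore] The toy activity is exp-linear on every class: `exp(o + h) = ∫ exp(o)·exp(id h) dδ`. -/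
theorem toy_actExpLinearOn (K : ℕ → (ℕ → ℝ) → toyCarriers.BgB → Set (ℂ × ℂ)) (W : Set (ℕ → ℝ)) :
    ActExpLinearOn toyIndexing toyAct toyData K W := by
  refine ⟨fun _ _ _ _ _ _ _ _ _ _ _ => ?_, fun _ _ _ _ q _ _ _ _ _ _ => ?_, fun _ _ _ _ _ _ _ _ _ _ _ _ => ?_,
    fun _ _ _ _ _ _ _ _ _ _ _ => ⟨1, ?_⟩, fun _ _ _ _ q _ _ _ _ _ _ => ?_⟩
  · show SigmaFinite (Measure.dirac ()); infer_instance
  · show Integrable (fun _ : Unit => Complex.exp q.1) (Measure.dirac ()); exact integrable_const _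
  · exact aestronglyMeasurable_const
  · exact Filter.Eventually.of_forall fun _ => by
      show ‖ContinuousLinearMap.id ℂ ℂ‖ ≤ 1
      exact ContinuousLinearMap.norm_id_le
  · show Complex.exp (q.1 + q.2) = ∫ _ : Unit, Complex.exp q.1 * Complex.exp (ContinuousLinearMap.id ℂ ℂ q.2)
      ∂(Measure.dirac ())
    rw [integral_dirac, ContinuousLinearMap.id_apply, Complex.exp_add]

/-- [folklore] Hence the toy's Ursell terms are exp-linear in the history with the exhibited data (the theorem fires). -/
theorem toy_termHistExpLinear (K : ℕ → (ℕ → ℝ) → toyCarriers.BgB → Set (ℂ × ℂ)) (W : Set (ℕ → ℝ)) :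
    TermHistExpLinear K (term toyIndexing (fun _ _ => True) toyAct) W (α := fun _ i => Fin (toyIndexing.len i + 1) → Unit)
      (fun _ i o _ => tupleMeasure toyIndexing toyData i o)
      (fun k i o X => tupleWeight toyIndexing (fun _ _ => True) toyData k i o X)
      (fun k i o X => tupleFunctional toyIndexing toyData k i o X) :=
  termHistExpLinear_of_actExpLinear (toy_actExpLinearOn K W)

/-- [folklore] The toy's one-polymer term is the activity itself: `T k 0 o h X = exp(o + h)` at step-`k` domains. -/
theorem toy_term_zero {k : ℕ} {X : toyCarriers.Dom} (hX : toyCarriers.scale X = k) (o h : ℂ) :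
    term toyIndexing (fun _ _ => True) toyAct k 0 o h X = Complex.exp (o + h) := by
  rw [term_single toyIndexing (fun _ _ => True) toyAct (i := 0) hX rfl]; exact Fin.prod_univ_one _

end Toy

end Summit.QuantumFields.BalabanUV.T4Continuum.B13StepTermFamily

end
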